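import Summits.ResolutionOfSingularities.ResolutionOfSingularities.Theorems.HilbertSamuelEliminationSigmaMaxModificationsCorridor3WLadderIsoLowSocket
import Summits.ResolutionOfSingularities.ResolutionOfSingularities.Theorems.HilbertSamuelEliminationSigmaMaxModificationsCorridor3InducesIsoOnPoint
import Summits.ResolutionOfSingularities.ResolutionOfSingularities.Theorems.HilbertSamuelEliminationSigmaMaxModificationsCorridor3WLadderResidue
import Literature.AlgebraicGeometry.Resolution.SigmaMaxEliminationInDim
import Literature.AlgebraicGeometry.CossartJannsenSaito2020.ProjDirLine
import Summits.ResolutionOfSingularities.ResolutionOfSingularities.Theorems.HilbertSamuelEliminationSigmaMaxModificationsCorridor3WLadderSegments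
import HarnessLib

/-!
# [OURS · L1 W4.2] THE THIRD DOOR CLOSED MODULO PRINT: `Moving.IsoLowDirDimTerminatesQM p` from five PRINTED named facts,
# the row `Wlow3CharM p` from print + two OURS constructions, and the crux residue re-cut (crux chain w42, line `w_ladder`
# v6; LEAD PROVER res-L1-w42-lead-1 gen 3; `--supports stmt-ResolutionOfSingularities-19249`, helper)

OURS (cell res-hironaka, slot W4.2); NOT statements of H. Hironaka's manuscript [Hironaka2017] nor of [CossartJannsenSaito2020];
AI proving, weaker than expert review. Sorry-free PROOF file (no new definition).

WHAT THIS FILE DOES. res-L1-w42-stub-2's `Moving.isoLowDirDimTerminatesQM_of_facts` (p510638) proves the third-door socket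
`IsoLowDirDimTerminatesQM p` (p502345) modulo the five printed binders `CossartJannsenSaito2020_thm_3_14` (p499700),
`CossartJannsenSaito2020_thm_3_10_4` (p499783), `Thm314_point_locus` + `ProjDir_line` (p503241), `Corollary637_char`, and two
LIB-shaped `∀`-binders: (EXC) «a blow-up of a locally noetherian excellent scheme is excellent» and (ISO-pt) «`InducesIsoOn π {y'} {y}`
at a `κ(y)`-rational closed point». BOTH LIB binders are theorems of the tree: (EXC) is `Scheme.IsExcellent.of_locallyOfFiniteType`
(`Literature/…/SigmaMaxEliminationInDim`, Matsumura §32 — blow-ups are proper, hence locally of finite type) and (ISO-pt) is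
`Helpers.inducesIsoOn_singleton_of_isIso_residueFieldMap` (p508941). Hence:

* `Moving.isoLowDirDimTerminatesQM_of_printed` — **THE THIRD DOOR modulo PRINT ONLY** (five named facts, no OURS hypothesis);
* `Moving.wlow3CharM_of_printed` — the ROW `Wlow3CharM p` (`stub_Wlow3M_char`) from SIX printed facts (`KeyTheorem640_char_isolated`
  added) and the TWO remaining OURS constructions `UnitTowerExtractionQM p` (U-seg, stub-1) and `Wlow3CharStrataM p` (strata, stub-4)
  — the shape RESHAPE RULE (H) of RULINGS v3.10-2 watches, with `IsoE1BridgeM` ELIMINATED;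
* `Residue.WB3M_of_residue'`, `Residue.sigmaMaxModificationsCorridor3_of_residue'` — the crux `SigmaMaxModificationsCorridor3` from
  SEVEN printed facts {`nuElimination`, `SequencePermissible`, `thm_3_10_4`, `KeyTheorem640_char_isolated`, `Corollary637_char`,
  `thm_3_14`, `Thm314_point_locus` ∧ `ProjDir_line`} and FIVE OURS rows {`UnitTowerExtractionQM`, `Wlow3CharStrataM`, `Wlow3TwoM`,
  `Wtop3PointedM`, `Wtop3NonpointedM`} (p507699 had six OURS rows; `∀ p, IsoE1BridgeM p` is gone).

## References

* V. Cossart, U. Jannsen, S. Saito, LNM 2270 (2020): Thm. 3.10 (4), Thm. 3.14, Def. 6.34, Cor. 6.37, Thm. 6.40, p. 107. [CossartJannsenSaito2020]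
* H. Matsumura, *Commutative Ring Theory* (1987), §32 p. 260. [Matsumura1987]
-/

noncomputable section

-- namespace `…Corridor3.Moving` re-enters `…Corridor3` (module convention of the Moving files)
set_option linter.dupNamespace false

open CategoryTheory CategoryTheory.Limits AlgebraicGeometry TopologicalSpace IsLocalRing
open Literature.AlgebraicGeometry.Resolution Literature.RingTheory.HilbertSamuel
open Literature.AlgebraicGeometry.CossartJannsenSaito2020
open Summit.ResolutionOfSingularities.ResolutionOfSingularities.Theses.HilbertSamuelElimination
open Summit.ResolutionOfSingularities.ResolutionOfSingularities.Theorems.CampaignW42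
open Summit.ResolutionOfSingularities.ResolutionOfSingularities.Theorems.SigmaMaxModificationsCorridor3

universe u

namespace Summit.ResolutionOfSingularities.ResolutionOfSingularities.Theorems.SigmaMaxModificationsCorridor3.Moving

/-! ## The two LIB binders are theorems of the tree -/

/-- **(EXC) A blow-up of a locally noetherian excellent scheme is excellent** (blow-ups are proper, hence locally of finite type;
Matsumura §32 p. 260 via the tree's `Scheme.IsExcellent.of_locallyOfFiniteType`). [cite: Matsumura1987, §32 p. 260] -/
theorem isExcellent_of_isBlowup {Y Y' : Scheme.{u}} [IsLocallyNoetherian Y] {π : Y' ⟶ Y} {I : Y.IdealSheafData}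
    (hπ : IsBlowup π I) (hY : Scheme.IsExcellent Y) : Scheme.IsExcellent Y' := by
  haveI : IsProper π := hπ.isProper
  haveI : IsLocallyNoetherian Y' := LocallyOfFiniteType.isLocallyNoetherian π
  exact Scheme.IsExcellent.of_locallyOfFiniteType π hY

/-- **(ISO-pt)** in the `∀`-binder shape of `isoLowDirDimTerminatesQM_of_facts` (the instance argument of p508941 made explicit).
[cite: CossartJannsenSaito2020, Def. 6.34 (i), p. 103] -/
theorem inducesIsoOn_singleton_of_isIso_residueFieldMap' {Y Y' : Scheme.{u}} (π : Y' ⟶ Y) {y' : Y'} {y : Y}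
    (hy' : IsClosed ({y'} : Set Y')) (hy : IsClosed ({y} : Set Y)) (h : π.base y' = y)
    (hi : IsIso (π.residueFieldMap y')) : InducesIsoOn π {y'} hy' {y} hy := by
  haveI := hi
  exact Helpers.inducesIsoOn_singleton_of_isIso_residueFieldMap π hy' hy h

/-! ## The third door modulo print -/

/-- **THE THIRD DOOR `IsoLowDirDimTerminatesQM p` MODULO PRINT ONLY**: in the (F1) regime, from a stage reached from a maximal origin at
level `3` that is isolated in the Hilbert–Samuel locus with `e ≤ 1`, no chain of canonical near steps is blown up infinitely often —
conditional on the five PRINTED named facts only (stub-2's `isoLowDirDimTerminatesQM_of_facts` with both LIB binders discharged).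
[cite: CossartJannsenSaito2020, Cor. 6.37, Thm. 3.14, Thm. 3.10 (4), Def. 6.34] -/
theorem isoLowDirDimTerminatesQM_of_printed (h314 : CossartJannsenSaito2020_thm_3_14.{0})
    (h3104 : CossartJannsenSaito2020_thm_3_10_4.{0}) (h314pt : Thm314_point_locus.{0}) (hline : ProjDir_line.{0})
    (hC637 : Corollary637_char.{0}) (p : ℕ) : IsoLowDirDimTerminatesQM p :=
  isoLowDirDimTerminatesQM_of_facts h314 h3104 h314pt hline hC637 (fun hπ hY => isExcellent_of_isBlowup hπ hY)
    (fun π _ _ hy' hy h hi => inducesIsoOn_singleton_of_isIso_residueFieldMap' π hy' hy h hi) p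

/-- **THE ROW `Wlow3CharM p` (`stub_Wlow3M_char`) from SIX PRINTED FACTS and the TWO remaining OURS CONSTRUCTIONS** `UnitTowerExtractionQM p`
(U-segment extraction, stub-1) and `Wlow3CharStrataM p` (strata half, stub-4): `wlow3CharM_assembledQ` (p502345) with the third door supplied by
`isoLowDirDimTerminatesQM_of_printed`. This is the shape RESHAPE RULE (H) watches; `IsoE1BridgeM` is no longer an input.
[cite: CossartJannsenSaito2020, Thm. 6.40, Cor. 6.37, Thm. 3.14, Thm. 3.10 (4)] -/
theorem wlow3CharM_of_printed (hK : KeyTheorem640_char_isolated.{0}) (hC637 : Corollary637_char.{0})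
    (h314 : CossartJannsenSaito2020_thm_3_14.{0}) (h3104 : CossartJannsenSaito2020_thm_3_10_4.{0})
    (h314pt : Thm314_point_locus.{0}) (hline : ProjDir_line.{0}) {p : ℕ} (hext : UnitTowerExtractionQM p)
    (hS : Wlow3CharStrataM p) : Wlow3CharM.{0} p :=
  wlow3CharM_assembledQ hK (isoLowDirDimTerminatesQM_of_printed h314 h3104 h314pt hline hC637 p) hext hS

end Summit.ResolutionOfSingularities.ResolutionOfSingularities.Theorems.SigmaMaxModificationsCorridor3.Moving

namespace Summit.ResolutionOfSingularities.ResolutionOfSingularities.Theorems.SigmaMaxModificationsCorridor3.Residue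

open Summit.ResolutionOfSingularities.ResolutionOfSingularities.Theorems.SigmaMaxModificationsCorridor3.Moving
open Summit.ResolutionOfSingularities.ResolutionOfSingularities.Theorems.SigmaMaxModificationsCorridor3.Helpers
open Summit.ResolutionOfSingularities.ResolutionOfSingularities.Cruxes.SigmaMaxModificationsCorridor3.WLadder

/-- **WB (moving, level `3`) from the RE-CUT residue**: as `WB3M_of_residue` (p507699) with the W-low-char row supplied by
`wlow3CharM_of_printed` — six printed facts, and the OURS rows {`UnitTowerExtractionQM`, `Wlow3CharStrataM`, `Wlow3TwoM`, `Wtop3PointedM`,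
`Wtop3NonpointedM`}. [cite: CossartJannsenSaito2020, Thm. 3.10 (4), Thm. 6.40, Cor. 6.37, Thm. 3.14] -/
theorem WB3M_of_residue' (h310 : CossartJannsenSaito2020_thm_3_10_4.{0}) (hK : KeyTheorem640_char_isolated.{0})
    (hC : Corollary637_char.{0}) (h314 : CossartJannsenSaito2020_thm_3_14.{0}) (h314pt : Thm314_point_locus.{0})
    (hline : ProjDir_line.{0}) (hU : ∀ p : ℕ, p.Prime → UnitTowerExtractionQM p) (hS : ∀ p : ℕ, p.Prime → Wlow3CharStrataM p)
    (hTwo : ∀ p : ℕ, p.Prime → Wlow3TwoM.{0} p) (hTopP : ∀ p : ℕ, p.Prime → Wtop3PointedM.{0} p)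
    (hTopN : ∀ p : ℕ, p.Prime → Wtop3NonpointedM.{0} p) : WB3M :=
  WB3M_of_rows5 (stub_Wmono_of_thm_3_10_4 h310)
    (fun p hp => wlow3CharM_of_printed hK hC h314 h310 h314pt hline (hU p hp) (hS p hp)) hTwo hTopP hTopN

/-- **THE CRUX `SigmaMaxModificationsCorridor3` FROM THE RE-CUT RESIDUE** — SEVEN printed named facts {`CossartJannsenSaito2020_nuElimination`,
`CossartJannsenSaito2020SequencePermissible`, `CossartJannsenSaito2020_thm_3_10_4`, `KeyTheorem640_char_isolated`, `Corollary637_char`,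
`CossartJannsenSaito2020_thm_3_14`, `Thm314_point_locus` ∧ `ProjDir_line`} and FIVE OURS rows {`UnitTowerExtractionQM`, `Wlow3CharStrataM`, `Wlow3TwoM`,
`Wtop3PointedM`, `Wtop3NonpointedM`} (the third door is no longer an OURS input: `sigmaMaxModificationsCorridor3_of_residue`, p507699, had six).
[cite: CossartJannsenSaito2020, Thm. 1.2, Thm. 3.10 (4), Thm. 3.14, Cor. 6.37, Thm. 6.40] -/
theorem sigmaMaxModificationsCorridor3_of_residue'
    (hNu : CossartJannsenSaito2020_nuElimination.{0}) (hSeq : CossartJannsenSaito2020SequencePermissible.{0})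
    (h310 : CossartJannsenSaito2020_thm_3_10_4.{0}) (hK : KeyTheorem640_char_isolated.{0}) (hC : Corollary637_char.{0})
    (h314 : CossartJannsenSaito2020_thm_3_14.{0}) (h314pt : Thm314_point_locus.{0}) (hline : ProjDir_line.{0})
    (hU : ∀ p : ℕ, p.Prime → UnitTowerExtractionQM p) (hS : ∀ p : ℕ, p.Prime → Wlow3CharStrataM p)
    (hTwo : ∀ p : ℕ, p.Prime → Wlow3TwoM.{0} p) (hTopP : ∀ p : ℕ, p.Prime → Wtop3PointedM.{0} p)
    (hTopN : ∀ p : ℕ, p.Prime → Wtop3NonpointedM.{0} p) : SigmaMaxModificationsCorridor3 := by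
  intro p hp k _ _ X f hsep hft hqc hred hreg _ h3' N hdim _ _
  exact hsBody_of_dim_le_three hNu
    (nuMod_three_of_WAM_WBM (WA3M_of_sequencePermissible hSeq)
      (WB3M_of_residue' h310 hK hC h314 h314pt hline hU hS hTwo hTopP hTopN))
    p hp k N X f hsep hft hqc hred hreg h3' hdim

end Summit.ResolutionOfSingularities.ResolutionOfSingularities.Theorems.SigmaMaxModificationsCorridor3.Residue

/-! ## Appendix (rev 2): `ProjDir_line` is PROVED in the tree (`projDir_line`, res-type-064, `ProjDirLine.lean`) — the char row in the
SHAPE OF RECORD of CHAIN v3.11a (15), five printed facts + two constructions -/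

namespace Summit.ResolutionOfSingularities.ResolutionOfSingularities.Theorems.SigmaMaxModificationsCorridor3.Moving

/-- **THE THIRD DOOR modulo FOUR printed facts** (`ProjDir_line` discharged by the tree's `projDir_line`).
[cite: CossartJannsenSaito2020, Cor. 6.37, Thm. 3.14, Thm. 3.10 (4), Def. 6.34 (i)] -/
theorem isoLowDirDimTerminatesQM_of_printed' (h314 : CossartJannsenSaito2020_thm_3_14.{0})
    (h3104 : CossartJannsenSaito2020_thm_3_10_4.{0}) (h314pt : Thm314_point_locus.{0}) (hC637 : Corollary637_char.{0}) (p : ℕ) :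
    IsoLowDirDimTerminatesQM p :=
  isoLowDirDimTerminatesQM_of_printed h314 h3104 h314pt projDir_line hC637 p

/-- **THE CHAR ROW `Wlow3CharM p` IN THE SHAPE OF RECORD (CHAIN v3.11a (15))**: five PRINTED named facts {`KeyTheorem640_char_isolated`,
`CossartJannsenSaito2020_thm_3_14`, `CossartJannsenSaito2020_thm_3_10_4`, `Thm314_point_locus`, `Corollary637_char`} and the TWO OURS constructions
`UnitTowerExtractionQM p` (U-segment extraction) and `Wlow3CharStrataM p` (strata half). [cite: CossartJannsenSaito2020, Thm. 6.40, Cor. 6.37, Thm. 3.14, Thm. 3.10 (4)] -/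
theorem wlow3CharM_of_printed_of_constructions (hK : KeyTheorem640_char_isolated.{0}) (h314 : CossartJannsenSaito2020_thm_3_14.{0})
    (h3104 : CossartJannsenSaito2020_thm_3_10_4.{0}) (h314pt : Thm314_point_locus.{0}) (hC637 : Corollary637_char.{0}) {p : ℕ}
    (hext : UnitTowerExtractionQM p) (hS : Wlow3CharStrataM p) : Wlow3CharM.{0} p :=
  wlow3CharM_of_printed hK hC637 h314 h3104 h314pt projDir_line hext hS

end Summit.ResolutionOfSingularities.ResolutionOfSingularities.Theorems.SigmaMaxModificationsCorridor3.Moving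

namespace Summit.ResolutionOfSingularities.ResolutionOfSingularities.Theorems.SigmaMaxModificationsCorridor3.Residue

open Summit.ResolutionOfSingularities.ResolutionOfSingularities.Theorems.SigmaMaxModificationsCorridor3.Moving

/-- **THE CRUX `SigmaMaxModificationsCorridor3` from SEVEN PRINTED NAMED FACTS (six sources — Thm. 3.14 enters in its numeric form
AND its point-locus form) and FIVE OURS rows** (`ProjDir_line` discharged): printed {`CossartJannsenSaito2020_nuElimination`,
`CossartJannsenSaito2020SequencePermissible`, `CossartJannsenSaito2020_thm_3_10_4`, `KeyTheorem640_char_isolated`, `Corollary637_char`,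
`CossartJannsenSaito2020_thm_3_14`, `Thm314_point_locus`}; OURS {`UnitTowerExtractionQM`, `Wlow3CharStrataM`, `Wlow3TwoM`, `Wtop3PointedM`,
`Wtop3NonpointedM`}. [cite: CossartJannsenSaito2020, Thm. 1.2, Thm. 3.10 (4), Thm. 3.14, Cor. 6.37, Thm. 6.40] -/
theorem sigmaMaxModificationsCorridor3_of_printed_of_rows
    (hNu : CossartJannsenSaito2020_nuElimination.{0}) (hSeq : CossartJannsenSaito2020SequencePermissible.{0})
    (h310 : CossartJannsenSaito2020_thm_3_10_4.{0}) (hK : KeyTheorem640_char_isolated.{0}) (hC : Corollary637_char.{0})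
    (h314 : CossartJannsenSaito2020_thm_3_14.{0}) (h314pt : Thm314_point_locus.{0})
    (hU : ∀ p : ℕ, p.Prime → UnitTowerExtractionQM p) (hS : ∀ p : ℕ, p.Prime → Wlow3CharStrataM p)
    (hTwo : ∀ p : ℕ, p.Prime → Wlow3TwoM.{0} p) (hTopP : ∀ p : ℕ, p.Prime → Wtop3PointedM.{0} p)
    (hTopN : ∀ p : ℕ, p.Prime → Wtop3NonpointedM.{0} p) : SigmaMaxModificationsCorridor3 :=
  sigmaMaxModificationsCorridor3_of_residue' hNu hSeq h310 hK hC h314 h314pt projDir_line hU hS hTwo hTopP hTopN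

end Summit.ResolutionOfSingularities.ResolutionOfSingularities.Theorems.SigmaMaxModificationsCorridor3.Residue

/-! ## Appendix (rev 3): the char row and the crux in the UNITS MODEL OF RECORD (b) — unit-wise LOCALISED chains (RULINGS v3.10-1 (A);
res-L1-w42-stub-1's `UnitTowerExtractionLocQM p`, p507549, assembled by `wlow3CharM_assembledLocQ`, …Corridor3WLadderSegments) with the
admissible F-key `KeyTheorem640_char_localized_isolated` (F-04c) -/

namespace Summit.ResolutionOfSingularities.ResolutionOfSingularities.Theorems.SigmaMaxModificationsCorridor3.Moving

/-- **THE CHAR ROW `Wlow3CharM p` IN MODEL (b)**: five PRINTED named facts {`KeyTheorem640_char_localized_isolated` (F-04c),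
`CossartJannsenSaito2020_thm_3_14`, `CossartJannsenSaito2020_thm_3_10_4`, `Thm314_point_locus`, `Corollary637_char`} and the TWO OURS
constructions `UnitTowerExtractionLocQM p` (unit-wise localised extraction, stub-1) and `Wlow3CharStrataM p` (strata half, stub-4).
[cite: CossartJannsenSaito2020, Thm. 6.40, Cor. 6.37, Thm. 3.14, Thm. 3.10 (4), p. 107] -/
theorem wlow3CharM_of_printed_of_constructionsLoc (hK : KeyTheorem640_char_localized_isolated.{0})
    (h314 : CossartJannsenSaito2020_thm_3_14.{0}) (h3104 : CossartJannsenSaito2020_thm_3_10_4.{0})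
    (h314pt : Thm314_point_locus.{0}) (hC637 : Corollary637_char.{0}) {p : ℕ} (hext : UnitTowerExtractionLocQM p)
    (hS : Wlow3CharStrataM p) : Wlow3CharM.{0} p :=
  wlow3CharM_assembledLocQ hK (isoLowDirDimTerminatesQM_of_printed' h314 h3104 h314pt hC637 p) hext hS

end Summit.ResolutionOfSingularities.ResolutionOfSingularities.Theorems.SigmaMaxModificationsCorridor3.Moving

namespace Summit.ResolutionOfSingularities.ResolutionOfSingularities.Theorems.SigmaMaxModificationsCorridor3.Residue

open Summit.ResolutionOfSingularities.ResolutionOfSingularities.Theorems.SigmaMaxModificationsCorridor3.Moving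
open Summit.ResolutionOfSingularities.ResolutionOfSingularities.Theorems.SigmaMaxModificationsCorridor3.Helpers

/-- **WB (moving, level `3`) in model (b).** [cite: CossartJannsenSaito2020, Thm. 3.10 (4), Thm. 6.40, Cor. 6.37, Thm. 3.14] -/
theorem WB3M_of_printed_of_rowsLoc (h310 : CossartJannsenSaito2020_thm_3_10_4.{0})
    (hK : KeyTheorem640_char_localized_isolated.{0}) (hC : Corollary637_char.{0}) (h314 : CossartJannsenSaito2020_thm_3_14.{0})
    (h314pt : Thm314_point_locus.{0}) (hU : ∀ p : ℕ, p.Prime → UnitTowerExtractionLocQM p)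
    (hS : ∀ p : ℕ, p.Prime → Wlow3CharStrataM p) (hTwo : ∀ p : ℕ, p.Prime → Wlow3TwoM.{0} p)
    (hTopP : ∀ p : ℕ, p.Prime → Wtop3PointedM.{0} p) (hTopN : ∀ p : ℕ, p.Prime → Wtop3NonpointedM.{0} p) : WB3M :=
  WB3M_of_rows5 (stub_Wmono_of_thm_3_10_4 h310)
    (fun p hp => wlow3CharM_of_printed_of_constructionsLoc hK h314 h310 h314pt hC (hU p hp) (hS p hp)) hTwo hTopP hTopN

/-- **THE CRUX `SigmaMaxModificationsCorridor3` IN THE UNITS MODEL OF RECORD (b)** — seven PRINTED named facts {`CossartJannsenSaito2020_nuElimination`,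
`CossartJannsenSaito2020SequencePermissible`, `CossartJannsenSaito2020_thm_3_10_4`, `KeyTheorem640_char_localized_isolated` (F-04c), `Corollary637_char`,
`CossartJannsenSaito2020_thm_3_14`, `Thm314_point_locus`} and FIVE OURS rows {`UnitTowerExtractionLocQM`, `Wlow3CharStrataM`, `Wlow3TwoM`,
`Wtop3PointedM`, `Wtop3NonpointedM`}. [cite: CossartJannsenSaito2020, Thm. 1.2, Thm. 3.10 (4), Thm. 3.14, Cor. 6.37, Thm. 6.40, p. 107] -/
theorem sigmaMaxModificationsCorridor3_of_printed_of_rowsLoc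
    (hNu : CossartJannsenSaito2020_nuElimination.{0}) (hSeq : CossartJannsenSaito2020SequencePermissible.{0})
    (h310 : CossartJannsenSaito2020_thm_3_10_4.{0}) (hK : KeyTheorem640_char_localized_isolated.{0}) (hC : Corollary637_char.{0})
    (h314 : CossartJannsenSaito2020_thm_3_14.{0}) (h314pt : Thm314_point_locus.{0})
    (hU : ∀ p : ℕ, p.Prime → UnitTowerExtractionLocQM p) (hS : ∀ p : ℕ, p.Prime → Wlow3CharStrataM p)
    (hTwo : ∀ p : ℕ, p.Prime → Wlow3TwoM.{0} p) (hTopP : ∀ p : ℕ, p.Prime → Wtop3PointedM.{0} p)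
    (hTopN : ∀ p : ℕ, p.Prime → Wtop3NonpointedM.{0} p) : SigmaMaxModificationsCorridor3 := by
  intro p hp k _ _ X f hsep hft hqc hred hreg _ h3' N hdim _ _
  exact hsBody_of_dim_le_three hNu
    (nuMod_three_of_WAM_WBM (WA3M_of_sequencePermissible hSeq)
      (WB3M_of_printed_of_rowsLoc h310 hK hC h314 h314pt hU hS hTwo hTopP hTopN))
    p hp k N X f hsep hft hqc hred hreg h3' hdim

end Summit.ResolutionOfSingularities.ResolutionOfSingularities.Theorems.SigmaMaxModificationsCorridor3.Residue

end
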